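import Summits.CriticalPhenomena.PercolationContinuityZ3.Theorems.Transplant.FKConnectivityAllQAntipodalTwoSpineBridgeSummand
import HarnessLib

/-!
# Two-spine word model of `U¹¹` — the SEMANTIC BRIDGE at a PARALLEL split node, part 1:
# the summand of `U¹¹(A ∥ B)` at a splitting configuration is a Janus half of `Θ_P(word, word)`

Helper file (`--supports stmt-CriticalPhenomena-4575`), FK sub-lane `prim-bschramm-fk-2` (gen 16); builds on p205010 (kernel theorem,
internal audit signed; external expert review pending).  No named facts, no sorries, standard axioms.

Memo `bschramm/FROM-fk-2-g15-TWO-SPINE.md` §1/§10.11 and blueprint `prim-bschramm-fk-2-g15/BLUEPRINT-U11-LEAN.md` L1/L3.  SETTING: a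
PARALLEL split node `N = A ∥ B` — `A` grown from the marked edge `y = y₁y₂` along the spine `psA` into a network between `s` and `t`
(`FK.IsSpine psA {y} y₁ y₂ A s t`), `B` grown from `z = z₁z₂` along `psB` between the same terminals, the two edge sets disjoint with
vertex spans meeting only in `{s, t}` (the side conditions of the parallel constructor of `FK.IsTTSP`).  Per configuration
`γ = X ⊔ Y ⊔ {y}` (`X ⊆ A∖y`, `Y ⊆ B∖z`) the summand of `U¹¹(A ∥ B)` is the `j = true` half of the PARALLEL-top coefficient
`Θ_P(word X, word Y)` of `…TwoSpineDefs` times `q^{expSum X + expSum Y} h(X ∪ Y)` (`psummand_inl`), by the parallel gluing identities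
of `…AntipodalGluing` (`apExp_parallel`: the two cross terms `1{s↔t in γ₁ and γ₂}`, `1{s↔t in γ₁ᶜ and γ₂ᶜ}` are exactly the parallel
cluster corrections of `Θ_P`; `reachable_union_parallel`: `∨` at the top) and the one-side row semantics of `…TwoSpineSem`; likewise
`γ = X ⊔ Y ⊔ {z}` (`psummand_inr`).  Part 2 (`…TwoSpinePBridge`) sums up; with the parallel-top rule theorem `dstmt_root_P`
(`…TwoSpineDualRule`) this gives Conjecture U¹¹ at every parallel split node.
[cite: Grimmett2006, §1.4 eq. (1.20) (p. 15); §3.8 (pp. 61–62); §3.9 (p. 63)]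
-/

noncomputable section

namespace Summit.CriticalPhenomena.PercolationContinuityZ3.Theorems

namespace FK

namespace TwoSpine

open SimpleGraph Literature.Probability.LatticeModels Literature.Probability.Percolation X2Word
open scoped Classical

variable {V : Type*} [Fintype V]

section Bridge

variable {psA psB : List (SpinePart V)} {A B : Finset (Sym2 V)} {V₁ V₂ : Set V} {y₁ y₂ z₁ z₂ s t : V}

omit [Fintype V] in
/-- **Parallel gluing, terminal connection as an `∨`**: `1{s ↔ t in γ₁ ⊔ γ₂} = c₁ + c₂ - c₁c₂`. [folklore] -/
theorem apConn_union_parallel (h₁ : ∀ e ∈ (↑A : Set (Sym2 V)), ∀ x ∈ e, x ∈ V₁) (h₂ : ∀ e ∈ (↑B : Set (Sym2 V)), ∀ x ∈ e, x ∈ V₂)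
    (hS : V₁ ∩ V₂ ⊆ {s, t}) {γ₁ γ₂ : Finset (Sym2 V)} (hγ₁ : γ₁ ⊆ A) (hγ₂ : γ₂ ⊆ B) :
    apConn (γ₁ ∪ γ₂) s t = apConn γ₁ s t + apConn γ₂ s t - apConn γ₁ s t * apConn γ₂ s t := by
  have hc := reachable_union_parallel h₁ h₂ hS hγ₁ hγ₂
  unfold apConn
  by_cases a₁ : (openGraph (↑γ₁ : BondConfig V)).Reachable s t <;>
  by_cases a₂ : (openGraph (↑γ₂ : BondConfig V)).Reachable s t
  · rw [if_pos (hc.2 (Or.inl a₁)), if_pos a₁, if_pos a₂]; ring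
  · rw [if_pos (hc.2 (Or.inl a₁)), if_pos a₁, if_neg a₂]; ring
  · rw [if_pos (hc.2 (Or.inr a₂)), if_neg a₁, if_pos a₂]; ring
  · rw [if_neg (fun hh => (hc.1 hh).elim a₁ a₂), if_neg a₁, if_neg a₂]; ring

/-- A joint connection indicator through the product of the two connection indicators. [folklore] -/
theorem ite_and_reachable_eq (γ₁ γ₂ : Finset (Sym2 V)) (a b c d : V) :
    (if (openGraph (↑γ₁ : BondConfig V)).Reachable a b ∧ (openGraph (↑γ₂ : BondConfig V)).Reachable c d then 1 else 0 : ℕ) =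
      if apConn γ₁ a b * apConn γ₂ c d = 1 then 1 else 0 := by
  unfold apConn
  by_cases h1 : (openGraph (↑γ₁ : BondConfig V)).Reachable a b <;>
  by_cases h2 : (openGraph (↑γ₂ : BondConfig V)).Reachable c d <;> norm_num [h1, h2]

/-- **The `j = true` summand, parallel top** (`γ = X ⊔ Y ⊔ {y}`): `q^{c} ·` (summand of `U¹¹(A ∥ B)` at `γ`) `= q^{4|V|} ·`
(`j = true` half of `Θ_P(word X, word Y)`) `· q^{expSum X} q^{expSum Y} h(X ∪ Y)`. [cite: Grimmett2006, §3.8 (pp. 61–62)] -/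
theorem psummand_inl (q : ℝ) (hA : IsSpine psA {s(y₁, y₂)} y₁ y₂ A s t) (hB : IsSpine psB {s(z₁, z₂)} z₁ z₂ B s t)
    (hy : y₁ ≠ y₂) (hz : z₁ ≠ z₂) (hd : Disjoint A B)
    (h₁ : ∀ e ∈ (↑A : Set (Sym2 V)), ∀ x ∈ e, x ∈ V₁) (h₂ : ∀ e ∈ (↑B : Set (Sym2 V)), ∀ x ∈ e, x ∈ V₂)
    (hS : V₁ ∩ V₂ ⊆ {s, t}) (hst : s ≠ t)
    {h : Finset (Sym2 V) → ℝ} (hhy : ∀ C, h (insert s(y₁, y₂) C) = h C)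
    {X Y : Finset (Sym2 V)} (hX : X ⊆ A.erase s(y₁, y₂)) (hY : Y ⊆ B.erase s(z₁, z₂)) :
    q ^ (2 + 2 * ((1 + psA.length + psB.length) * Fintype.card V)) *
      (q ^ apExp (A ∪ B) (insert s(y₁, y₂) X ∪ Y) *
        (splitInd s(y₁, y₂) s(z₁, z₂) (insert s(y₁, y₂) X ∪ Y) *
          ((apConn (insert s(y₁, y₂) X ∪ Y) s t - apConn ((A ∪ B) \ (insert s(y₁, y₂) X ∪ Y)) s t) *
            h (insert s(y₁, y₂) X ∪ Y)))) =
    q ^ (4 * Fintype.card V) *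
      (q ^ baseExp (Mode.o, Mode.o, Mode.o, Mode.o) (spineWord psA (A.erase s(y₁, y₂)) X) (spineWord psB (B.erase s(z₁, z₂)) Y) *
        (q ^ (2 - Mode.o.del (sRowA (spineWord psA (A.erase s(y₁, y₂)) X)) -
              Mode.o.del (sRowB (spineWord psB (B.erase s(z₁, z₂)) Y))) *
          (q ^ (if Mode.o.connDot (sRowA (spineWord psA (A.erase s(y₁, y₂)) X)) * Mode.o.conn (sRowA (spineWord psB (B.erase s(z₁, z₂)) Y)) = 1
              then 1 else 0 : ℕ) *
            q ^ (if Mode.o.conn (sRowB (spineWord psA (A.erase s(y₁, y₂)) X)) * Mode.o.connDot (sRowB (spineWord psB (B.erase s(z₁, z₂)) Y)) = 1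
              then 1 else 0 : ℕ)) *
          ((Mode.o.connDot (sRowA (spineWord psA (A.erase s(y₁, y₂)) X)) + Mode.o.conn (sRowA (spineWord psB (B.erase s(z₁, z₂)) Y)) -
              Mode.o.connDot (sRowA (spineWord psA (A.erase s(y₁, y₂)) X)) * Mode.o.conn (sRowA (spineWord psB (B.erase s(z₁, z₂)) Y))) -
            (Mode.o.conn (sRowB (spineWord psA (A.erase s(y₁, y₂)) X)) + Mode.o.connDot (sRowB (spineWord psB (B.erase s(z₁, z₂)) Y)) -
              Mode.o.conn (sRowB (spineWord psA (A.erase s(y₁, y₂)) X)) * Mode.o.connDot (sRowB (spineWord psB (B.erase s(z₁, z₂)) Y))))) *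
        (q ^ expSum psA (A.erase s(y₁, y₂)) X * (q ^ expSum psB (B.erase s(z₁, z₂)) Y * h (X ∪ Y)))) := by
  set y : Sym2 V := s(y₁, y₂) with hy_def
  set z : Sym2 V := s(z₁, z₂) with hz_def
  set TA := A.erase y with hTA
  set TB := B.erase z with hTB
  set u := spineWord psA TA X with hu
  set v := spineWord psB TB Y with hv
  have hyA : y ∈ A := marked_mem hA
  have hzB : z ∈ B := marked_mem hB
  have hzA : z ∉ A := fun hh => Finset.disjoint_left.1 hd hh hzB
  have hXA : X ⊆ A := hX.trans (Finset.erase_subset _ _)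
  have hYB : Y ⊆ B := hY.trans (Finset.erase_subset _ _)
  have hγ₁ : insert y X ⊆ A := Finset.insert_subset hyA hXA
  -- the configuration splits `{y, z}`: `y ∈ γ`, `z ∉ γ`
  have hyγ : y ∈ insert y X ∪ Y := Finset.mem_union_left _ (Finset.mem_insert_self _ _)
  have hzγ : z ∉ insert y X ∪ Y := by
    rw [Finset.mem_union, Finset.mem_insert, not_or, not_or]
    exact ⟨⟨fun hzy => hzA (hzy ▸ hyA), fun hzX => hzA (hXA hzX)⟩, fun hzY => Finset.notMem_erase z B (hY hzY)⟩
  have hsplit : splitInd y z (insert y X ∪ Y) = 1 := by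
    unfold splitInd; rw [if_pos (iff_of_true hyγ hzγ)]
  have hhγ : h (insert y X ∪ Y) = h (X ∪ Y) := by rw [Finset.insert_union, hhy]
  -- complements
  have hcompl : (A ∪ B) \ (insert y X ∪ Y) = (TA \ X) ∪ insert z (TB \ Y) := by
    rw [union_sdiff_union hd hγ₁ hYB, sdiff_insert_eq_erase_sdiff, sdiff_eq_insert_erase_sdiff hzB hY]
  have hA1 : A \ insert y X = TA \ X := sdiff_insert_eq_erase_sdiff A X y
  have hB1 : B \ Y = insert z (TB \ Y) := sdiff_eq_insert_erase_sdiff hzB hY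
  -- exponents
  have hexp := apExp_parallel hd h₁ h₂ hS hst (subset_rfl : A ⊆ A) (subset_rfl : B ⊆ B) hγ₁ hYB
  rw [hA1, hB1, ite_and_reachable_eq, ite_and_reachable_eq, ← connDot_o_rowA hA hy subset_rfl hX, ← conn_o_rowA hB hz subset_rfl hY,
    ← conn_o_rowB hA hy subset_rfl X, ← connDot_o_rowB hB hz subset_rfl Y] at hexp
  have E1 : q ^ (2 * Fintype.card V) * q ^ apExp (A ∪ B) (insert y X ∪ Y) =
      q ^ clusterCount (↑(insert y X) : BondConfig V) ∅ * q ^ clusterCount (↑(TA \ X) : BondConfig V) ∅ *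
        (q ^ clusterCount (↑Y : BondConfig V) ∅ * q ^ clusterCount (↑(insert z (TB \ Y)) : BondConfig V) ∅) *
        (q ^ (if Mode.o.connDot (sRowA u) * Mode.o.conn (sRowA v) = 1 then 1 else 0 : ℕ) *
          q ^ (if Mode.o.conn (sRowB u) * Mode.o.connDot (sRowB v) = 1 then 1 else 0 : ℕ)) := by
    rw [← pow_add, add_comm, hexp]
    unfold apExp
    rw [hA1, hB1, pow_add, pow_add, pow_add, pow_add, pow_add]
  have E2 := pow_clusterCount_insert_rowA q hA hy (subset_rfl : TA ⊆ A.erase y) hX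
  have E3 := pow_clusterCount_insert_rowB q hB hz (subset_rfl : TB ⊆ B.erase z) Y
  have E4 : q ^ clusterCount (↑X : BondConfig V) ∅ * q ^ clusterCount (↑(TA \ X) : BondConfig V) ∅ *
      q ^ (2 * (psA.length * Fintype.card V)) =
      q ^ (2 * Fintype.card V) * q ^ (rowCorr (sRowA u) + rowCorr (sRowB u)) * q ^ expSum psA TA X := by
    rw [← pow_add q (clusterCount (↑X : BondConfig V) ∅)]
    exact pow_apExp_rowCorr q hA hy (subset_rfl : TA ⊆ A.erase y) hX
  have E5 : q ^ clusterCount (↑Y : BondConfig V) ∅ * q ^ clusterCount (↑(TB \ Y) : BondConfig V) ∅ *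
      q ^ (2 * (psB.length * Fintype.card V)) =
      q ^ (2 * Fintype.card V) * q ^ (rowCorr (sRowA v) + rowCorr (sRowB v)) * q ^ expSum psB TB Y := by
    rw [← pow_add q (clusterCount (↑Y : BondConfig V) ∅)]
    exact pow_apExp_rowCorr q hB hz (subset_rfl : TB ⊆ B.erase z) hY
  -- connections
  have C1 : apConn (insert y X ∪ Y) s t =
      Mode.o.connDot (sRowA u) + Mode.o.conn (sRowA v) - Mode.o.connDot (sRowA u) * Mode.o.conn (sRowA v) := by
    rw [apConn_union_parallel h₁ h₂ hS hγ₁ hYB, connDot_o_rowA hA hy subset_rfl hX, conn_o_rowA hB hz subset_rfl hY]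
  have C2 : apConn ((A ∪ B) \ (insert y X ∪ Y)) s t =
      Mode.o.conn (sRowB u) + Mode.o.connDot (sRowB v) - Mode.o.conn (sRowB u) * Mode.o.connDot (sRowB v) := by
    rw [hcompl, apConn_union_parallel h₁ h₂ hS (Finset.sdiff_subset.trans (Finset.erase_subset _ _))
      (Finset.insert_subset hzB (Finset.sdiff_subset.trans (Finset.erase_subset _ _))),
      conn_o_rowB hA hy subset_rfl X, connDot_o_rowB hB hz subset_rfl Y]
  -- exponent bookkeeping in `ℕ`
  have hC : 2 + 2 * ((1 + psA.length + psB.length) * Fintype.card V) =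
      2 + (2 * Fintype.card V + 2 * (psA.length * Fintype.card V) + 2 * (psB.length * Fintype.card V)) := by ring
  have hdA := rowDel_le_one (sRowA u)
  have hdB := rowDel_le_one (sRowB v)
  have hδ : 2 - Mode.o.del (sRowA u) - Mode.o.del (sRowB v) = (1 - Mode.o.del (sRowA u)) + (1 - Mode.o.del (sRowB v)) := by
    simp only [Mode.del]; omega
  have h4 : 4 * Fintype.card V = 2 * Fintype.card V + 2 * Fintype.card V := by ring
  have hQC : q ^ (2 + 2 * ((1 + psA.length + psB.length) * Fintype.card V)) =
      q ^ 2 * (q ^ (2 * Fintype.card V) * q ^ (2 * (psA.length * Fintype.card V)) * q ^ (2 * (psB.length * Fintype.card V))) := by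
    rw [hC, pow_add, pow_add, pow_add]
  have hbase : q ^ baseExp (Mode.o, Mode.o, Mode.o, Mode.o) u v =
      q ^ (rowCorr (sRowA u) + rowCorr (sRowB u)) * q ^ (rowCorr (sRowA v) + rowCorr (sRowB v)) := by
    rw [baseExp_root, add_assoc (rowCorr (sRowA u) + rowCorr (sRowB u)), pow_add]
  have hδ' : q ^ (2 - Mode.o.del (sRowA u) - Mode.o.del (sRowB v)) = q ^ (1 - Mode.o.del (sRowA u)) * q ^ (1 - Mode.o.del (sRowB v)) := by
    rw [hδ, pow_add]
  have h4' : q ^ (4 * Fintype.card V) = q ^ (2 * Fintype.card V) * q ^ (2 * Fintype.card V) := by rw [h4, pow_add]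
  rw [hsplit, one_mul, hhγ, C1, C2, hQC, hbase, hδ', h4']
  linear_combination
    (q ^ (2 * (psA.length * Fintype.card V)) * q ^ (2 * (psB.length * Fintype.card V)) *
        ((Mode.o.connDot (sRowA u) + Mode.o.conn (sRowA v) - Mode.o.connDot (sRowA u) * Mode.o.conn (sRowA v) -
          (Mode.o.conn (sRowB u) + Mode.o.connDot (sRowB v) - Mode.o.conn (sRowB u) * Mode.o.connDot (sRowB v))) * h (X ∪ Y)) * q ^ 2) * E1 +
    (q ^ (2 * (psA.length * Fintype.card V)) * q ^ (2 * (psB.length * Fintype.card V)) *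
        ((Mode.o.connDot (sRowA u) + Mode.o.conn (sRowA v) - Mode.o.connDot (sRowA u) * Mode.o.conn (sRowA v) -
          (Mode.o.conn (sRowB u) + Mode.o.connDot (sRowB v) - Mode.o.conn (sRowB u) * Mode.o.connDot (sRowB v))) * h (X ∪ Y)) *
        (q ^ (if Mode.o.connDot (sRowA u) * Mode.o.conn (sRowA v) = 1 then 1 else 0 : ℕ) *
          q ^ (if Mode.o.conn (sRowB u) * Mode.o.connDot (sRowB v) = 1 then 1 else 0 : ℕ)) *
        q ^ clusterCount (↑(TA \ X) : BondConfig V) ∅ * q ^ clusterCount (↑Y : BondConfig V) ∅ *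
        (q * q ^ clusterCount (↑(insert z (TB \ Y)) : BondConfig V) ∅)) * E2 +
    (q ^ (2 * (psA.length * Fintype.card V)) * q ^ (2 * (psB.length * Fintype.card V)) *
        ((Mode.o.connDot (sRowA u) + Mode.o.conn (sRowA v) - Mode.o.connDot (sRowA u) * Mode.o.conn (sRowA v) -
          (Mode.o.conn (sRowB u) + Mode.o.connDot (sRowB v) - Mode.o.conn (sRowB u) * Mode.o.connDot (sRowB v))) * h (X ∪ Y)) *
        (q ^ (if Mode.o.connDot (sRowA u) * Mode.o.conn (sRowA v) = 1 then 1 else 0 : ℕ) *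
          q ^ (if Mode.o.conn (sRowB u) * Mode.o.connDot (sRowB v) = 1 then 1 else 0 : ℕ)) *
        q ^ clusterCount (↑(TA \ X) : BondConfig V) ∅ * q ^ clusterCount (↑Y : BondConfig V) ∅ *
        (q ^ clusterCount (↑X : BondConfig V) ∅ * q ^ (1 - Mode.o.del (sRowA u)))) * E3 +
    (((Mode.o.connDot (sRowA u) + Mode.o.conn (sRowA v) - Mode.o.connDot (sRowA u) * Mode.o.conn (sRowA v) -
          (Mode.o.conn (sRowB u) + Mode.o.connDot (sRowB v) - Mode.o.conn (sRowB u) * Mode.o.connDot (sRowB v))) * h (X ∪ Y)) *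
        (q ^ (if Mode.o.connDot (sRowA u) * Mode.o.conn (sRowA v) = 1 then 1 else 0 : ℕ) *
          q ^ (if Mode.o.conn (sRowB u) * Mode.o.connDot (sRowB v) = 1 then 1 else 0 : ℕ)) *
        q ^ (1 - Mode.o.del (sRowA u)) * q ^ (1 - Mode.o.del (sRowB v)) *
        (q ^ (2 * (psB.length * Fintype.card V)) * q ^ clusterCount (↑Y : BondConfig V) ∅ *
          q ^ clusterCount (↑(TB \ Y) : BondConfig V) ∅)) * E4 +
    (((Mode.o.connDot (sRowA u) + Mode.o.conn (sRowA v) - Mode.o.connDot (sRowA u) * Mode.o.conn (sRowA v) -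
          (Mode.o.conn (sRowB u) + Mode.o.connDot (sRowB v) - Mode.o.conn (sRowB u) * Mode.o.connDot (sRowB v))) * h (X ∪ Y)) *
        (q ^ (if Mode.o.connDot (sRowA u) * Mode.o.conn (sRowA v) = 1 then 1 else 0 : ℕ) *
          q ^ (if Mode.o.conn (sRowB u) * Mode.o.connDot (sRowB v) = 1 then 1 else 0 : ℕ)) *
        q ^ (1 - Mode.o.del (sRowA u)) * q ^ (1 - Mode.o.del (sRowB v)) *
        (q ^ (2 * Fintype.card V) * q ^ (rowCorr (sRowA u) + rowCorr (sRowB u)) * q ^ expSum psA TA X)) * E5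

/-- **The `j = false` summand, parallel top** (`γ = X ⊔ Y ⊔ {z}`): `q^{c} ·` (summand of `U¹¹(A ∥ B)` at `γ`) `= q^{4|V|} ·`
(`j = false` half of `Θ_P(word X, word Y)`) `· q^{expSum X} q^{expSum Y} h(X ∪ Y)`. [cite: Grimmett2006, §3.8 (pp. 61–62)] -/
theorem psummand_inr (q : ℝ) (hA : IsSpine psA {s(y₁, y₂)} y₁ y₂ A s t) (hB : IsSpine psB {s(z₁, z₂)} z₁ z₂ B s t)
    (hy : y₁ ≠ y₂) (hz : z₁ ≠ z₂) (hd : Disjoint A B)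
    (h₁ : ∀ e ∈ (↑A : Set (Sym2 V)), ∀ x ∈ e, x ∈ V₁) (h₂ : ∀ e ∈ (↑B : Set (Sym2 V)), ∀ x ∈ e, x ∈ V₂)
    (hS : V₁ ∩ V₂ ⊆ {s, t}) (hst : s ≠ t)
    {h : Finset (Sym2 V) → ℝ} (hhz : ∀ C, h (insert s(z₁, z₂) C) = h C)
    {X Y : Finset (Sym2 V)} (hX : X ⊆ A.erase s(y₁, y₂)) (hY : Y ⊆ B.erase s(z₁, z₂)) :
    q ^ (2 + 2 * ((1 + psA.length + psB.length) * Fintype.card V)) *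
      (q ^ apExp (A ∪ B) (X ∪ insert s(z₁, z₂) Y) *
        (splitInd s(y₁, y₂) s(z₁, z₂) (X ∪ insert s(z₁, z₂) Y) *
          ((apConn (X ∪ insert s(z₁, z₂) Y) s t - apConn ((A ∪ B) \ (X ∪ insert s(z₁, z₂) Y)) s t) *
            h (X ∪ insert s(z₁, z₂) Y)))) =
    q ^ (4 * Fintype.card V) *
      (q ^ baseExp (Mode.o, Mode.o, Mode.o, Mode.o) (spineWord psA (A.erase s(y₁, y₂)) X) (spineWord psB (B.erase s(z₁, z₂)) Y) *
        (q ^ (2 - Mode.o.del (sRowB (spineWord psA (A.erase s(y₁, y₂)) X)) -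
              Mode.o.del (sRowA (spineWord psB (B.erase s(z₁, z₂)) Y))) *
          (q ^ (if Mode.o.conn (sRowA (spineWord psA (A.erase s(y₁, y₂)) X)) * Mode.o.connDot (sRowA (spineWord psB (B.erase s(z₁, z₂)) Y)) = 1
              then 1 else 0 : ℕ) *
            q ^ (if Mode.o.connDot (sRowB (spineWord psA (A.erase s(y₁, y₂)) X)) * Mode.o.conn (sRowB (spineWord psB (B.erase s(z₁, z₂)) Y)) = 1
              then 1 else 0 : ℕ)) *
          ((Mode.o.conn (sRowA (spineWord psA (A.erase s(y₁, y₂)) X)) + Mode.o.connDot (sRowA (spineWord psB (B.erase s(z₁, z₂)) Y)) -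
              Mode.o.conn (sRowA (spineWord psA (A.erase s(y₁, y₂)) X)) * Mode.o.connDot (sRowA (spineWord psB (B.erase s(z₁, z₂)) Y))) -
            (Mode.o.connDot (sRowB (spineWord psA (A.erase s(y₁, y₂)) X)) + Mode.o.conn (sRowB (spineWord psB (B.erase s(z₁, z₂)) Y)) -
              Mode.o.connDot (sRowB (spineWord psA (A.erase s(y₁, y₂)) X)) * Mode.o.conn (sRowB (spineWord psB (B.erase s(z₁, z₂)) Y))))) *
        (q ^ expSum psA (A.erase s(y₁, y₂)) X * (q ^ expSum psB (B.erase s(z₁, z₂)) Y * h (X ∪ Y)))) := by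
  set y : Sym2 V := s(y₁, y₂) with hy_def
  set z : Sym2 V := s(z₁, z₂) with hz_def
  set TA := A.erase y with hTA
  set TB := B.erase z with hTB
  set u := spineWord psA TA X with hu
  set v := spineWord psB TB Y with hv
  have hyA : y ∈ A := marked_mem hA
  have hzB : z ∈ B := marked_mem hB
  have hyB : y ∉ B := fun hh => Finset.disjoint_left.1 hd hyA hh
  have hXA : X ⊆ A := hX.trans (Finset.erase_subset _ _)
  have hYB : Y ⊆ B := hY.trans (Finset.erase_subset _ _)
  have hγ₂ : insert z Y ⊆ B := Finset.insert_subset hzB hYB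
  -- the configuration splits `{y, z}`: `y ∉ γ`, `z ∈ γ`
  have hzγ : z ∈ X ∪ insert z Y := Finset.mem_union_right _ (Finset.mem_insert_self _ _)
  have hyγ : y ∉ X ∪ insert z Y := by
    rw [Finset.mem_union, Finset.mem_insert, not_or, not_or]
    exact ⟨fun hyX => Finset.notMem_erase y A (hX hyX), fun hyz => hyB (hyz ▸ hzB), fun hyY => hyB (hYB hyY)⟩
  have hsplit : splitInd y z (X ∪ insert z Y) = 1 := by
    unfold splitInd; rw [if_pos (iff_of_false hyγ (fun hn => hn hzγ))]
  have hhγ : h (X ∪ insert z Y) = h (X ∪ Y) := by rw [Finset.union_insert, hhz]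
  -- complements
  have hA1 : A \ X = insert y (TA \ X) := sdiff_eq_insert_erase_sdiff hyA hX
  have hB1 : B \ insert z Y = TB \ Y := sdiff_insert_eq_erase_sdiff B Y z
  have hcompl : (A ∪ B) \ (X ∪ insert z Y) = insert y (TA \ X) ∪ (TB \ Y) := by
    rw [union_sdiff_union hd hXA hγ₂, hA1, hB1]
  -- exponents
  have hexp := apExp_parallel hd h₁ h₂ hS hst (subset_rfl : A ⊆ A) (subset_rfl : B ⊆ B) hXA hγ₂
  rw [hA1, hB1, ite_and_reachable_eq, ite_and_reachable_eq, ← conn_o_rowA hA hy subset_rfl hX, ← connDot_o_rowA hB hz subset_rfl hY,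
    ← connDot_o_rowB hA hy subset_rfl X, ← conn_o_rowB hB hz subset_rfl Y] at hexp
  have E1 : q ^ (2 * Fintype.card V) * q ^ apExp (A ∪ B) (X ∪ insert z Y) =
      q ^ clusterCount (↑X : BondConfig V) ∅ * q ^ clusterCount (↑(insert y (TA \ X)) : BondConfig V) ∅ *
        (q ^ clusterCount (↑(insert z Y) : BondConfig V) ∅ * q ^ clusterCount (↑(TB \ Y) : BondConfig V) ∅) *
        (q ^ (if Mode.o.conn (sRowA u) * Mode.o.connDot (sRowA v) = 1 then 1 else 0 : ℕ) *
          q ^ (if Mode.o.connDot (sRowB u) * Mode.o.conn (sRowB v) = 1 then 1 else 0 : ℕ)) := by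
    rw [← pow_add, add_comm, hexp]
    unfold apExp
    rw [hA1, hB1, pow_add, pow_add, pow_add, pow_add, pow_add]
  have E2 := pow_clusterCount_insert_rowB q hA hy (subset_rfl : TA ⊆ A.erase y) X
  have E3 := pow_clusterCount_insert_rowA q hB hz (subset_rfl : TB ⊆ B.erase z) hY
  have E4 : q ^ clusterCount (↑X : BondConfig V) ∅ * q ^ clusterCount (↑(TA \ X) : BondConfig V) ∅ *
      q ^ (2 * (psA.length * Fintype.card V)) =
      q ^ (2 * Fintype.card V) * q ^ (rowCorr (sRowA u) + rowCorr (sRowB u)) * q ^ expSum psA TA X := by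
    rw [← pow_add q (clusterCount (↑X : BondConfig V) ∅)]
    exact pow_apExp_rowCorr q hA hy (subset_rfl : TA ⊆ A.erase y) hX
  have E5 : q ^ clusterCount (↑Y : BondConfig V) ∅ * q ^ clusterCount (↑(TB \ Y) : BondConfig V) ∅ *
      q ^ (2 * (psB.length * Fintype.card V)) =
      q ^ (2 * Fintype.card V) * q ^ (rowCorr (sRowA v) + rowCorr (sRowB v)) * q ^ expSum psB TB Y := by
    rw [← pow_add q (clusterCount (↑Y : BondConfig V) ∅)]
    exact pow_apExp_rowCorr q hB hz (subset_rfl : TB ⊆ B.erase z) hY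
  -- connections
  have C1 : apConn (X ∪ insert z Y) s t =
      Mode.o.conn (sRowA u) + Mode.o.connDot (sRowA v) - Mode.o.conn (sRowA u) * Mode.o.connDot (sRowA v) := by
    rw [apConn_union_parallel h₁ h₂ hS hXA hγ₂, conn_o_rowA hA hy subset_rfl hX, connDot_o_rowA hB hz subset_rfl hY]
  have C2 : apConn ((A ∪ B) \ (X ∪ insert z Y)) s t =
      Mode.o.connDot (sRowB u) + Mode.o.conn (sRowB v) - Mode.o.connDot (sRowB u) * Mode.o.conn (sRowB v) := by
    rw [hcompl, apConn_union_parallel h₁ h₂ hS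
      (Finset.insert_subset hyA (Finset.sdiff_subset.trans (Finset.erase_subset _ _))) (Finset.sdiff_subset.trans (Finset.erase_subset _ _)),
      connDot_o_rowB hA hy subset_rfl X, conn_o_rowB hB hz subset_rfl Y]
  -- exponent bookkeeping in `ℕ`
  have hC : 2 + 2 * ((1 + psA.length + psB.length) * Fintype.card V) =
      2 + (2 * Fintype.card V + 2 * (psA.length * Fintype.card V) + 2 * (psB.length * Fintype.card V)) := by ring
  have hdA := rowDel_le_one (sRowB u)
  have hdB := rowDel_le_one (sRowA v)
  have hδ : 2 - Mode.o.del (sRowB u) - Mode.o.del (sRowA v) = (1 - Mode.o.del (sRowB u)) + (1 - Mode.o.del (sRowA v)) := by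
    simp only [Mode.del]; omega
  have h4 : 4 * Fintype.card V = 2 * Fintype.card V + 2 * Fintype.card V := by ring
  have hQC : q ^ (2 + 2 * ((1 + psA.length + psB.length) * Fintype.card V)) =
      q ^ 2 * (q ^ (2 * Fintype.card V) * q ^ (2 * (psA.length * Fintype.card V)) * q ^ (2 * (psB.length * Fintype.card V))) := by
    rw [hC, pow_add, pow_add, pow_add]
  have hbase : q ^ baseExp (Mode.o, Mode.o, Mode.o, Mode.o) u v =
      q ^ (rowCorr (sRowA u) + rowCorr (sRowB u)) * q ^ (rowCorr (sRowA v) + rowCorr (sRowB v)) := by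
    rw [baseExp_root, add_assoc (rowCorr (sRowA u) + rowCorr (sRowB u)), pow_add]
  have hδ' : q ^ (2 - Mode.o.del (sRowB u) - Mode.o.del (sRowA v)) = q ^ (1 - Mode.o.del (sRowB u)) * q ^ (1 - Mode.o.del (sRowA v)) := by
    rw [hδ, pow_add]
  have h4' : q ^ (4 * Fintype.card V) = q ^ (2 * Fintype.card V) * q ^ (2 * Fintype.card V) := by rw [h4, pow_add]
  rw [hsplit, one_mul, hhγ, C1, C2, hQC, hbase, hδ', h4']
  linear_combination
    (q ^ (2 * (psA.length * Fintype.card V)) * q ^ (2 * (psB.length * Fintype.card V)) *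
        ((Mode.o.conn (sRowA u) + Mode.o.connDot (sRowA v) - Mode.o.conn (sRowA u) * Mode.o.connDot (sRowA v) -
          (Mode.o.connDot (sRowB u) + Mode.o.conn (sRowB v) - Mode.o.connDot (sRowB u) * Mode.o.conn (sRowB v))) * h (X ∪ Y)) * q ^ 2) * E1 +
    (q ^ (2 * (psA.length * Fintype.card V)) * q ^ (2 * (psB.length * Fintype.card V)) *
        ((Mode.o.conn (sRowA u) + Mode.o.connDot (sRowA v) - Mode.o.conn (sRowA u) * Mode.o.connDot (sRowA v) -
          (Mode.o.connDot (sRowB u) + Mode.o.conn (sRowB v) - Mode.o.connDot (sRowB u) * Mode.o.conn (sRowB v))) * h (X ∪ Y)) *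
        (q ^ (if Mode.o.conn (sRowA u) * Mode.o.connDot (sRowA v) = 1 then 1 else 0 : ℕ) *
          q ^ (if Mode.o.connDot (sRowB u) * Mode.o.conn (sRowB v) = 1 then 1 else 0 : ℕ)) *
        q ^ clusterCount (↑X : BondConfig V) ∅ * q ^ clusterCount (↑(TB \ Y) : BondConfig V) ∅ *
        (q * q ^ clusterCount (↑(insert z Y) : BondConfig V) ∅)) * E2 +
    (q ^ (2 * (psA.length * Fintype.card V)) * q ^ (2 * (psB.length * Fintype.card V)) *
        ((Mode.o.conn (sRowA u) + Mode.o.connDot (sRowA v) - Mode.o.conn (sRowA u) * Mode.o.connDot (sRowA v) -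
          (Mode.o.connDot (sRowB u) + Mode.o.conn (sRowB v) - Mode.o.connDot (sRowB u) * Mode.o.conn (sRowB v))) * h (X ∪ Y)) *
        (q ^ (if Mode.o.conn (sRowA u) * Mode.o.connDot (sRowA v) = 1 then 1 else 0 : ℕ) *
          q ^ (if Mode.o.connDot (sRowB u) * Mode.o.conn (sRowB v) = 1 then 1 else 0 : ℕ)) *
        q ^ clusterCount (↑X : BondConfig V) ∅ * q ^ clusterCount (↑(TB \ Y) : BondConfig V) ∅ *
        (q ^ clusterCount (↑(TA \ X) : BondConfig V) ∅ * q ^ (1 - Mode.o.del (sRowB u)))) * E3 +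
    (((Mode.o.conn (sRowA u) + Mode.o.connDot (sRowA v) - Mode.o.conn (sRowA u) * Mode.o.connDot (sRowA v) -
          (Mode.o.connDot (sRowB u) + Mode.o.conn (sRowB v) - Mode.o.connDot (sRowB u) * Mode.o.conn (sRowB v))) * h (X ∪ Y)) *
        (q ^ (if Mode.o.conn (sRowA u) * Mode.o.connDot (sRowA v) = 1 then 1 else 0 : ℕ) *
          q ^ (if Mode.o.connDot (sRowB u) * Mode.o.conn (sRowB v) = 1 then 1 else 0 : ℕ)) *
        q ^ (1 - Mode.o.del (sRowB u)) * q ^ (1 - Mode.o.del (sRowA v)) *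
        (q ^ (2 * (psB.length * Fintype.card V)) * q ^ clusterCount (↑Y : BondConfig V) ∅ *
          q ^ clusterCount (↑(TB \ Y) : BondConfig V) ∅)) * E4 +
    (((Mode.o.conn (sRowA u) + Mode.o.connDot (sRowA v) - Mode.o.conn (sRowA u) * Mode.o.connDot (sRowA v) -
          (Mode.o.connDot (sRowB u) + Mode.o.conn (sRowB v) - Mode.o.connDot (sRowB u) * Mode.o.conn (sRowB v))) * h (X ∪ Y)) *
        (q ^ (if Mode.o.conn (sRowA u) * Mode.o.connDot (sRowA v) = 1 then 1 else 0 : ℕ) *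
          q ^ (if Mode.o.connDot (sRowB u) * Mode.o.conn (sRowB v) = 1 then 1 else 0 : ℕ)) *
        q ^ (1 - Mode.o.del (sRowB u)) * q ^ (1 - Mode.o.del (sRowA v)) *
        (q ^ (2 * Fintype.card V) * q ^ (rowCorr (sRowA u) + rowCorr (sRowB u)) * q ^ expSum psA TA X)) * E5

end Bridge

end TwoSpine

end FK

end Summit.CriticalPhenomena.PercolationContinuityZ3.Theorems

end
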